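import Literature.AlgebraicGeometry.HodgeTheory.AbelianVarietyHodgeFullnessHolds
import Literature.AlgebraicGeometry.Milne1999.TateFromCodesHCOfRiemann
import HarnessLib

/-!
# A simple complex abelian variety of CM type is isogenous to one with a CM-type realisation —
# UNCONDITIONALLY

Family `hodge`, layer `Literature/AlgebraicGeometry/Milne1999`. One theorem; no definition, no named
fact. The tree's `hSimplePos_of_riemann` (`TateFromCodesHCOfRiemann.lean`; the step «`A` simple of
CM type ⇒ `A ∼ A_{(K;Φ)}` for a CM type `(K;Φ)`» of [Milne1999LefschetzClasses] / [Deligne1982HodgeCycles]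
I Prop. 5.1 + §5 p. 37, via Shimura's isogeny theorem) carried Riemann's theorem as the hypothesis
`hR`; it is now the theorem `HodgeTheory.deligneMilne1982_Thm_6_20_full_holds`.

## References

* P. Deligne, *Hodge cycles on abelian varieties*, LNM 900 (1982), I Prop. 5.1, §5 (p. 37).
  [Deligne1982HodgeCycles]
* P. Deligne, J. S. Milne, *Tannakian categories*, LNM 900 (1982), Thm. 6.20. [DeligneMilne1982Tannakian]
-/

noncomputable section

namespace Literature.AlgebraicGeometry.Milne1999

open Literature.AlgebraicGeometry.HodgeTheory Literature.AlgebraicGeometry.Motives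

/-- **Every simple positive-dimensional complex abelian variety of CM type (`Milne1999.IsOfCMType`,
the binder of `HC_CM`) is isogenous to an abelian variety carrying a CM-type realisation
(`IsCMTyped`)** ([Deligne1982HodgeCycles] I Prop. 5.1 and §5 p. 37; Shimura §6.2) — unconditional form
of `hSimplePos_of_riemann`. [cite: Deligne1982HodgeCycles, I Prop. 5.1 and §5 (p. 37)]
[cite: DeligneMilne1982Tannakian, Thm. 6.20] -/
theorem exists_isCMTyped_isIsogenous_of_isSimple :
    ∀ B : AbelianVariety ℂ, AbelianVariety.IsSimple B → 0 < B.dim → IsOfCMType B →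
      ∃ B' : AbelianVariety ℂ, IsCMTyped B' ∧ AbelianVariety.IsIsogenous B B' :=
  hSimplePos_of_riemann deligneMilne1982_Thm_6_20_full_holds

end Literature.AlgebraicGeometry.Milne1999

end
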